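import Mathlib.LinearAlgebra.Matrix.PosDef
import Literature.Analysis.FunctionSpaces.TorusPlantingTools
import HarnessLib

/-!
# Planting a sink completion and a stirring cell in the unit cube: the cube fields

Analysis/FluidPDE support file (everything proved; no definitions, no named facts). Bookkeeping
for the torus scaffold of the point-sink construction (`Summits/AnomalousDissipation`; vocabulary
of De Lellis–Székelyhidi 2010, §2): a *sink completion* `(U, R)` on `ℝ³` — a velocity/stress
pair equal to a rough germ on `0 < |x| < r₀`, smooth with `R ≻ 0` on `|x| > r₀`, and at rest
`(0, c·Id)` for `|x| ≥ r₁`, `r₁ ≤ 1/16` — is translated to the centre `q = (½, ½, ½)` of the unit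
cube, and a smooth *stirring cell* `(W, S, f)` supported in the ball `B(p, 1/16)`,
`p = (⅛, ½, ½)`, is added. The resulting cube fields
`U_c(y) = U(y − q) + W(y)`, `S_c(y) = (R(y − q) − c·Id) + S(y)` vanish off the open unit cube, and
this file records, as functions of the defining equations (no definitions are introduced):

* the geometry of `q`, `p` (`closedBall_cellCentre_subset_openCube`,
  `not_mem_ball_cellCentre_of_norm_lt`, `le_norm_sub_centre_of_mem_ball_cellCentre`);
* vanishing off the open cube and the values near `q` (`cubeFields_eq_zero_of_not_mem_openCube`,
  `cubeFields_apply_centre_add`);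
* smoothness of all lattice translates on the lattice-distance set
  `A = {v | ∀ w, proj w = 0 → r₀ < ‖v − w‖}` and positive definiteness of
  `c·Id + perSum S_c (q + ·)` on `A` (`contDiffOn_cubeVelocity_translate`,
  `contDiffOn_cubeStress_translate`, `posDef_cubeStress_perSum`);
* integrability: `U_c ∈ L²(ℝ³)`, `S_c ∈ L¹(ℝ³)` (`memLp_cubeVelocity`, `integrable_cubeStress`).

The torus-side statements (weak divergence-freeness, the weak Euler–Reynolds identity with source,
the power) are in `EulerReynoldsTorusPlanting.lean`.

## References

* C. De Lellis, L. Székelyhidi Jr., Arch. Ration. Mech. Anal. 195 (2010), §2 (subsolutions).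
* L. Grafakos, *Classical Fourier Analysis*, 3rd ed. (2014), §3.1.1 (the fundamental cube).
-/

noncomputable section

open MeasureTheory Set Function Filter Metric
open scoped RealInnerProductSpace ContDiff Topology
open Literature.Analysis.FunctionSpaces

namespace Literature.Analysis.FluidPDE

/-! ### Geometry of the two centres -/

section Geometry

variable {q p : EuclideanSpace ℝ (Fin 3)}

/-- Coordinates are bounded by the norm (private helper). [folklore] -/
private theorem abs_coord_le_norm (v : EuclideanSpace ℝ (Fin 3)) (i : Fin 3) : |v i| ≤ ‖v‖ := by
  have h := PiLp.norm_apply_le v i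
  rwa [Real.norm_eq_abs] at h

/-- The closed ball of radius `1/16` about the cell centre `p = (⅛, ½, ½)` lies in the open unit
cube. [folklore] -/
theorem closedBall_cellCentre_subset_openCube (hp : ∀ i, p i = if i = 0 then 1 / 8 else 1 / 2) :
    closedBall p (1 / 16) ⊆ {y : EuclideanSpace ℝ (Fin 3) | ∀ i, y i ∈ Ioo (0 : ℝ) 1} := by
  intro y hy i
  rw [mem_closedBall, dist_eq_norm] at hy
  have h1 := (abs_coord_le_norm (y - p) i).trans hy
  rw [PiLp.sub_apply, hp i, abs_le] at h1
  simp only [mem_Ioo]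
  split_ifs at h1 <;> constructor <;> linarith [h1.1, h1.2]

/-- Near the cube centre one is far from the cell: for `‖v‖ < 5/16`, `q + v ∉ B(p, 1/16)`
(`q = (½,½,½)`, `p = (⅛,½,½)`, `|p − q| = 3/8`). [folklore] -/
theorem not_mem_ball_cellCentre_of_norm_lt (hq : ∀ i, q i = 1 / 2)
    (hp : ∀ i, p i = if i = 0 then 1 / 8 else 1 / 2) {v : EuclideanSpace ℝ (Fin 3)}
    (hv : ‖v‖ < 5 / 16) : q + v ∉ ball p (1 / 16) := by
  intro h
  rw [mem_ball, dist_eq_norm] at h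
  have h1 := (abs_coord_le_norm (q + v - p) 0).trans h.le
  have h2 := abs_coord_le_norm v 0
  rw [PiLp.sub_apply, PiLp.add_apply, hq 0, hp 0, if_pos rfl, abs_le] at h1
  rw [abs_le] at h2
  linarith [h1.1, h1.2, h2.1, h2.2]

/-- Points of the cell ball are far from the cube centre: `z ∈ B(p, 1/16)` implies
`5/16 ≤ ‖z − q‖`. [folklore] -/
theorem le_norm_sub_centre_of_mem_ball_cellCentre (hq : ∀ i, q i = 1 / 2)
    (hp : ∀ i, p i = if i = 0 then 1 / 8 else 1 / 2) {z : EuclideanSpace ℝ (Fin 3)}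
    (hz : z ∈ ball p (1 / 16)) : 5 / 16 ≤ ‖z - q‖ := by
  rw [mem_ball, dist_eq_norm] at hz
  have h1 := (abs_coord_le_norm (z - p) 0).trans hz.le
  have h2 := abs_coord_le_norm (z - q) 0
  rw [PiLp.sub_apply, hp 0, if_pos rfl, abs_le] at h1
  rw [PiLp.sub_apply, hq 0, abs_le] at h2
  refine le_trans ?_ (abs_coord_le_norm (z - q) 0)
  rw [PiLp.sub_apply, hq 0, abs_of_nonpos (by linarith [h1.2])]
  linarith [h1.1, h1.2]

end Geometry

/-! ### The cube fields -/

section Fields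

variable {q p : EuclideanSpace ℝ (Fin 3)} {U W f : EuclideanSpace ℝ (Fin 3) → EuclideanSpace ℝ (Fin 3)}
  {R S : EuclideanSpace ℝ (Fin 3) → Fin 3 → Fin 3 → ℝ} {r₀ r₁ c : ℝ}
  {Uc : EuclideanSpace ℝ (Fin 3) → EuclideanSpace ℝ (Fin 3)}
  {Sc : EuclideanSpace ℝ (Fin 3) → Fin 3 → Fin 3 → ℝ}

/-- **Off the open cube everything is at rest.** For `y` outside the open unit cube:
`U(y − q) = 0`, `R(y − q) = c·Id` (as `|y − q| ≥ ½ ≥ r₁`) and `W y = 0`, `S y = 0`, `f y = 0`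
(the cell ball lies in the open cube). [folklore] -/
theorem sink_cell_eq_of_not_mem_openCube (hq : ∀ i, q i = 1 / 2)
    (hp : ∀ i, p i = if i = 0 then 1 / 8 else 1 / 2) (hr₁ : r₁ ≤ 1 / 16)
    (hrest : ∀ x : EuclideanSpace ℝ (Fin 3), r₁ ≤ ‖x‖ →
      U x = 0 ∧ R x = fun i j => if i = j then c else 0)
    (hWs : tsupport W ⊆ ball p (1 / 16)) (hfs : tsupport f ⊆ ball p (1 / 16))
    (hSs : tsupport S ⊆ ball p (1 / 16)) {y : EuclideanSpace ℝ (Fin 3)}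
    (hy : ¬ ∀ i, y i ∈ Ioo (0 : ℝ) 1) :
    (U (y - q) = 0 ∧ R (y - q) = fun i j => if i = j then c else 0) ∧
      W y = 0 ∧ S y = 0 ∧ f y = 0 := by
  have hyq : r₁ ≤ ‖y - q‖ :=
    le_trans (by linarith) (Torus.half_le_norm_sub_of_not_mem_openCube hq hy)
  have hyp : y ∉ ball p (1 / 16) := fun h =>
    hy (closedBall_cellCentre_subset_openCube hp (ball_subset_closedBall h))
  exact ⟨hrest _ hyq, image_eq_zero_of_notMem_tsupport fun h => hyp (hWs h),
    image_eq_zero_of_notMem_tsupport fun h => hyp (hSs h),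
    image_eq_zero_of_notMem_tsupport fun h => hyp (hfs h)⟩

/-- The cube fields `U_c(y) = U(y − q) + W y`, `S_c(y) = (R(y − q) − c·Id) + S y` and the force
`f` vanish off the open unit cube. [folklore] -/
theorem cubeFields_eq_zero_of_not_mem_openCube (hq : ∀ i, q i = 1 / 2)
    (hp : ∀ i, p i = if i = 0 then 1 / 8 else 1 / 2) (hr₁ : r₁ ≤ 1 / 16)
    (hrest : ∀ x : EuclideanSpace ℝ (Fin 3), r₁ ≤ ‖x‖ →
      U x = 0 ∧ R x = fun i j => if i = j then c else 0)
    (hWs : tsupport W ⊆ ball p (1 / 16)) (hfs : tsupport f ⊆ ball p (1 / 16))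
    (hSs : tsupport S ⊆ ball p (1 / 16)) (hUc : Uc = fun y => U (y - q) + W y)
    (hSc : Sc = fun y i j => (R (y - q) i j - if i = j then c else 0) + S y i j) :
    (∀ y, (¬ ∀ i, y i ∈ Ioo (0 : ℝ) 1) → Uc y = 0) ∧
      (∀ y, (¬ ∀ i, y i ∈ Ioo (0 : ℝ) 1) → Sc y = 0) ∧
      (∀ y, (¬ ∀ i, y i ∈ Ioo (0 : ℝ) 1) → f y = 0) := by
  refine ⟨fun y hy => ?_, fun y hy => ?_, fun y hy => ?_⟩ <;>
    obtain ⟨⟨hU, hR⟩, hW, hS, hf⟩ := sink_cell_eq_of_not_mem_openCube hq hp hr₁ hrest hWs hfs hSs hy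
  · simp [hUc, hU, hW]
  · funext i j
    simp [hSc, hR, hS]
  · exact hf

/-- **Values near the centre.** For `‖v‖ < 5/16` the cube fields at `q + v` see only the sink:
`perSum U_c (q + v) = U_c (q + v) = U v`, `perSum S_c (q + v) = S_c (q + v) = R v − c·Id`,
`perSum f (q + v) = 0`. [folklore] -/
theorem cubeFields_apply_centre_add (hq : ∀ i, q i = 1 / 2)
    (hp : ∀ i, p i = if i = 0 then 1 / 8 else 1 / 2) (hr₁ : r₁ ≤ 1 / 16)
    (hrest : ∀ x : EuclideanSpace ℝ (Fin 3), r₁ ≤ ‖x‖ →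
      U x = 0 ∧ R x = fun i j => if i = j then c else 0)
    (hWs : tsupport W ⊆ ball p (1 / 16)) (hfs : tsupport f ⊆ ball p (1 / 16))
    (hSs : tsupport S ⊆ ball p (1 / 16)) (hUc : Uc = fun y => U (y - q) + W y)
    (hSc : Sc = fun y i j => (R (y - q) i j - if i = j then c else 0) + S y i j)
    {v : EuclideanSpace ℝ (Fin 3)} (hv : ‖v‖ < 5 / 16) :
    Torus.perSum Uc (q + v) = U v ∧
      (Torus.perSum Sc (q + v) = fun i j => R v i j - if i = j then c else 0) ∧
      Torus.perSum f (q + v) = 0 := by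
  obtain ⟨hUc0, hSc0, hf0⟩ :=
    cubeFields_eq_zero_of_not_mem_openCube hq hp hr₁ hrest hWs hfs hSs hUc hSc
  have hcube := (Torus.add_mem_unitCube_of_norm_lt hq (lt_trans hv (by norm_num))).1
  have hvp : q + v ∉ ball p (1 / 16) := not_mem_ball_cellCentre_of_norm_lt hq hp hv
  have hW : W (q + v) = 0 := image_eq_zero_of_notMem_tsupport fun h => hvp (hWs h)
  have hS : S (q + v) = 0 := image_eq_zero_of_notMem_tsupport fun h => hvp (hSs h)
  have hf : f (q + v) = 0 := image_eq_zero_of_notMem_tsupport fun h => hvp (hfs h)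
  rw [Torus.perSum_eq_self_of_mem_unitCube hUc0 hcube, Torus.perSum_eq_self_of_mem_unitCube hSc0 hcube,
    Torus.perSum_eq_self_of_mem_unitCube hf0 hcube, hUc, hSc]
  refine ⟨by simp [hW], ?_, hf⟩
  funext i j
  simp [hS]

/-! ### Smoothness of the lattice translates on the lattice-distance set -/

/-- Every lattice translate `v ↦ U_c (q + v + k)` is smooth on the lattice-distance set
`A = {v | ∀ w, proj w = 0 → r₀ < ‖v − w‖}` (`U` is smooth on `|x| > r₀`, `W` everywhere).
[folklore] -/
theorem contDiffOn_cubeVelocity_translate (hUs : ContDiffOn ℝ ∞ U {x | r₀ < ‖x‖})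
    (hW : ContDiff ℝ ∞ W) (hUc : Uc = fun y => U (y - q) + W y) (k : Fin 3 → ℤ) :
    ContDiffOn ℝ ∞ (fun v => Uc (q + v + Torus.latticeVec k))
      {v : EuclideanSpace ℝ (Fin 3) | ∀ w, Torus.proj w = 0 → r₀ < ‖v - w‖} := by
  have h1 : ContDiffOn ℝ ∞ (fun v : EuclideanSpace ℝ (Fin 3) => U (v + Torus.latticeVec k))
      {v : EuclideanSpace ℝ (Fin 3) | ∀ w, Torus.proj w = 0 → r₀ < ‖v - w‖} :=
    hUs.comp (contDiff_id.add contDiff_const).contDiffOn fun v hv =>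
      Torus.lt_norm_add_latticeVec_of_forall hv k
  have h2 : ContDiffOn ℝ ∞ (fun v : EuclideanSpace ℝ (Fin 3) => W (q + v + Torus.latticeVec k))
      {v : EuclideanSpace ℝ (Fin 3) | ∀ w, Torus.proj w = 0 → r₀ < ‖v - w‖} :=
    (hW.comp ((contDiff_const.add contDiff_id).add contDiff_const)).contDiffOn
  have h3 : (fun v => Uc (q + v + Torus.latticeVec k)) = fun v =>
      U (v + Torus.latticeVec k) + W (q + v + Torus.latticeVec k) := by
    funext v
    rw [hUc]
    simp only [add_assoc, add_sub_cancel_left]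
  rw [h3]
  exact h1.add h2

/-- Every lattice translate `v ↦ S_c (q + v + k)` is smooth on the lattice-distance set.
[folklore] -/
theorem contDiffOn_cubeStress_translate (hRs : ContDiffOn ℝ ∞ R {x | r₀ < ‖x‖})
    (hS : ContDiff ℝ ∞ S)
    (hSc : Sc = fun y i j => (R (y - q) i j - if i = j then c else 0) + S y i j)
    (k : Fin 3 → ℤ) :
    ContDiffOn ℝ ∞ (fun v => Sc (q + v + Torus.latticeVec k))
      {v : EuclideanSpace ℝ (Fin 3) | ∀ w, Torus.proj w = 0 → r₀ < ‖v - w‖} := by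
  have h1 : ContDiffOn ℝ ∞ (fun v : EuclideanSpace ℝ (Fin 3) => R (v + Torus.latticeVec k))
      {v : EuclideanSpace ℝ (Fin 3) | ∀ w, Torus.proj w = 0 → r₀ < ‖v - w‖} :=
    hRs.comp (contDiff_id.add contDiff_const).contDiffOn fun v hv =>
      Torus.lt_norm_add_latticeVec_of_forall hv k
  have h2 : ContDiffOn ℝ ∞ (fun v : EuclideanSpace ℝ (Fin 3) => S (q + v + Torus.latticeVec k))
      {v : EuclideanSpace ℝ (Fin 3) | ∀ w, Torus.proj w = 0 → r₀ < ‖v - w‖} :=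
    (hS.comp ((contDiff_const.add contDiff_id).add contDiff_const)).contDiffOn
  have h3 : (fun v => Sc (q + v + Torus.latticeVec k)) = fun v =>
      (R (v + Torus.latticeVec k) - fun i j => if i = j then c else (0 : ℝ)) +
        S (q + v + Torus.latticeVec k) := by
    funext v
    rw [hSc]
    funext i j
    simp only [Pi.add_apply, Pi.sub_apply]
    congr 2
    abel
  rw [h3]
  exact (h1.sub contDiffOn_const).add h2

/-! ### Positive definiteness of the planted stress -/

/-- **The planted stress is positive definite off the germ balls.** On the lattice-distance set
`A`, `c·Id + perSum S_c (q + v)` is positive definite: the lattice sum is `S_c` read at the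
representative `z = q + v + k` of `q + v` in the fundamental cube; inside the cell ball it equals
`c·Id + S(z) ≻ 0`, elsewhere it is `R(v + k)` with `|v + k| > r₀`, positive definite by
hypothesis. [folklore] -/
theorem posDef_cubeStress_perSum (hq : ∀ i, q i = 1 / 2)
    (hp : ∀ i, p i = if i = 0 then 1 / 8 else 1 / 2) (hr₁ : r₁ ≤ 1 / 16)
    (hrest : ∀ x : EuclideanSpace ℝ (Fin 3), r₁ ≤ ‖x‖ →
      U x = 0 ∧ R x = fun i j => if i = j then c else 0)
    (hpos : ∀ x : EuclideanSpace ℝ (Fin 3), r₀ < ‖x‖ → (Matrix.of (R x)).PosDef)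
    (hWs : tsupport W ⊆ ball p (1 / 16)) (hfs : tsupport f ⊆ ball p (1 / 16))
    (hSs : tsupport S ⊆ ball p (1 / 16))
    (hScell : ∀ x, (Matrix.of fun i j => (if i = j then c else 0) + S x i j).PosDef)
    (hUc : Uc = fun y => U (y - q) + W y)
    (hSc : Sc = fun y i j => (R (y - q) i j - if i = j then c else 0) + S y i j)
    {v : EuclideanSpace ℝ (Fin 3)} (hv : ∀ w, Torus.proj w = 0 → r₀ < ‖v - w‖) :
    (Matrix.of fun i j => (if i = j then c else 0) + Torus.perSum Sc (q + v) i j).PosDef := by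
  obtain ⟨-, hSc0, -⟩ :=
    cubeFields_eq_zero_of_not_mem_openCube hq hp hr₁ hrest hWs hfs hSs hUc hSc
  obtain ⟨k, hk⟩ := Torus.exists_repr_proj_eq_add_latticeVec_holds (q + v)
  rw [Torus.perSum_eq_apply_repr_proj hSc0 (q + v), hk]
  set z := q + v + Torus.latticeVec k with hz
  have hzq : z - q = v + Torus.latticeVec k := by rw [hz]; abel
  by_cases hzp : z ∈ ball p (1 / 16)
  · -- inside the cell ball: the sink is at rest there
    have hfar : r₁ ≤ ‖z - q‖ :=
      le_trans (by linarith) (le_norm_sub_centre_of_mem_ball_cellCentre hq hp hzp)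
    have hR := (hrest _ hfar).2
    have heq : (fun i j => (if i = j then c else 0) + Sc z i j) =
        fun i j => (if i = j then c else 0) + S z i j := by
      funext i j
      simp [hSc, hR]
    rw [heq]
    exact hScell z
  · -- outside the cell ball: the stress is `R (v + k)`, `|v + k| > r₀`
    have hS : S z = 0 := image_eq_zero_of_notMem_tsupport fun h => hzp (hSs h)
    have heq : (fun i j => (if i = j then c else 0) + Sc z i j) = R (z - q) := by
      funext i j
      simp [hSc, hS]
    rw [heq, hzq]
    exact hpos _ (Torus.lt_norm_add_latticeVec_of_forall hv k)

/-! ### Integrability -/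

/-- The cube velocity is square integrable on `ℝ³` (`U ∈ L²`, `W` continuous with compact
support). [folklore] -/
theorem memLp_cubeVelocity (hU : MemLp U 2 volume) (hW : ContDiff ℝ ∞ W)
    (hWs : tsupport W ⊆ ball p (1 / 16)) (hUc : Uc = fun y => U (y - q) + W y) :
    MemLp Uc 2 volume := by
  have hWc : HasCompactSupport W := HasCompactSupport.of_support_subset_isCompact
    (isCompact_closedBall p (1 / 16)) ((subset_tsupport W).trans (hWs.trans ball_subset_closedBall))
  rw [hUc]
  exact (hU.comp_measurePreserving (measurePreserving_sub_right volume q)).add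
    (hW.continuous.memLp_of_hasCompactSupport hWc)

/-- The cube stress is integrable on `ℝ³` (`R − c·Id ∈ L¹(B_{r₁})` and vanishes outside, `S`
continuous with compact support). [folklore] -/
theorem integrable_cubeStress
    (hrest : ∀ x : EuclideanSpace ℝ (Fin 3), r₁ ≤ ‖x‖ →
      U x = 0 ∧ R x = fun i j => if i = j then c else 0)
    (hR : IntegrableOn R (ball (0 : EuclideanSpace ℝ (Fin 3)) r₁) volume) (hS : ContDiff ℝ ∞ S)
    (hSs : tsupport S ⊆ ball p (1 / 16))
    (hSc : Sc = fun y i j => (R (y - q) i j - if i = j then c else 0) + S y i j) :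
    Integrable Sc volume := by
  have hSc' : Sc = (fun y => R (y - q) - fun i j => if i = j then c else (0 : ℝ)) + S := by
    rw [hSc]
    funext y i j
    simp
  rw [hSc']
  have hScpt : HasCompactSupport S := HasCompactSupport.of_support_subset_isCompact
    (isCompact_closedBall p (1 / 16)) ((subset_tsupport S).trans (hSs.trans ball_subset_closedBall))
  refine Integrable.add ?_ (hS.continuous.integrable_of_hasCompactSupport hScpt)
  -- the translated stress minus the rest level is integrable on the ball and vanishes outside
  have hpre : (fun y : EuclideanSpace ℝ (Fin 3) => y - q) ⁻¹' ball 0 r₁ = ball q r₁ := by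
    ext y
    simp [dist_eq_norm]
  have hRq : IntegrableOn (fun y => R (y - q)) (ball q r₁) volume := by
    rw [← hpre]
    exact ((measurePreserving_sub_right volume q).integrableOn_comp_preimage
      (Homeomorph.subRight q).measurableEmbedding).2 hR
  have hball : IntegrableOn (fun y => R (y - q) - fun i j => if i = j then c else (0 : ℝ))
      (ball q r₁) volume :=
    hRq.sub (integrableOn_const (measure_ball_lt_top.ne))
  refine hball.integrable_of_forall_notMem_eq_zero fun y hy => ?_
  have hyq : r₁ ≤ ‖y - q‖ := by
    rw [mem_ball, dist_eq_norm, not_lt] at hy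
    exact hy
  rw [(hrest _ hyq).2, sub_self]

end Fields

end Literature.Analysis.FluidPDE
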